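import Literature.Analysis.Complex.OsgoodProofs
import Mathlib.Analysis.Calculus.ContDiff.CPolynomial
import HarnessLib

/-!
# Uniform approximation by Taylor polynomials on balls of `ℂ`-normed spaces (Hörmander, Thm. 2.2.6/2.2.7)

For `h : E → F` complex-differentiable on the open ball `ball c R` of a finite-dimensional
complex normed space `E` (values in a complete space `F`), the **Taylor polynomials**

  `taylorPolynomial h c N y = ∑_{n<N} (n!)⁻¹ • Dⁿh(c)(y - c, …, y - c)`

are entire (`differentiable_taylorPolynomial`) and converge to `h` **uniformly on every closed
ball `closedBall c s`, `s < R`** (`tendstoUniformlyOn_taylorPolynomial`,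
`exists_taylorPolynomial_approx`): the normal convergence of the power series of a holomorphic
function on compact subsets of its polydisc/ball of holomorphy (Hörmander (1973), Thm. 2.2.6 with
the Cauchy estimates 2.2.7). Proof: restrict to the complex lines through `c`
(`Complex.hasSum_taylorSeries_on_ball` on the slice `t ↦ h (c + t (y - c))`, holomorphic for
`|t| < R/s`) and bound the coefficients by Cauchy's inequality on a circle of radius `R'/s > 1`
(`Complex.norm_iteratedDeriv_le_of_forall_mem_sphere_norm_le`), uniformly in `y` by the bound
of `h` on `closedBall c R'`.

This is the approximation ("Runge for concentric balls") used in the `q = 0` case of the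
`∂̄`-exhaustion (Hörmander (1973), proof of Thm. 2.7.8).

## References

* L. Hörmander, *An Introduction to Complex Analysis in Several Variables*, 2nd ed. (1973),
  Thms. 2.2.6, 2.2.7, and proof of Thm. 2.7.8. [HormanderSCV1973]
-/

noncomputable section

open scoped Topology Nat
open Complex Metric Set Filter Finset

namespace Literature.Analysis.Complex

variable {E : Type*} [NormedAddCommGroup E] [NormedSpace ℂ E]
  {F : Type*} [NormedAddCommGroup F] [NormedSpace ℂ F]

/-! ### Taylor polynomials -/

/-- The **Taylor polynomial** of order `< N` of `h` at `c`:
`y ↦ ∑_{n<N} (n!)⁻¹ • Dⁿh(c)(y - c, …, y - c)`. [cite: HormanderSCV1973, Thm. 2.2.6] -/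
def taylorPolynomial (h : E → F) (c : E) (N : ℕ) (y : E) : F :=
  ∑ n ∈ Finset.range N, ((n ! : ℂ)⁻¹ • iteratedFDeriv ℂ n h c fun _ => y - c)

/-- Unfolding of `taylorPolynomial`. [folklore] -/
theorem taylorPolynomial_apply (h : E → F) (c : E) (N : ℕ) (y : E) :
    taylorPolynomial h c N y = ∑ n ∈ Finset.range N, ((n ! : ℂ)⁻¹ • iteratedFDeriv ℂ n h c fun _ => y - c) :=
  rfl

/-- Each Taylor monomial `y ↦ Dⁿh(c)(y - c, …, y - c)` is entire (a continuous homogeneous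
polynomial). [folklore] -/
theorem differentiable_iteratedFDeriv_diag (h : E → F) (c : E) (n : ℕ) :
    Differentiable ℂ fun y : E => iteratedFDeriv ℂ n h c fun _ => y - c :=
  ((iteratedFDeriv ℂ n h c).contDiff.differentiable (n := 1) one_ne_zero).comp
    ((differentiable_pi.2 fun _ => differentiable_id.sub_const c))

/-- **Taylor polynomials are entire.** [folklore] -/
theorem differentiable_taylorPolynomial (h : E → F) (c : E) (N : ℕ) :
    Differentiable ℂ (taylorPolynomial h c N) := by
  have : taylorPolynomial h c N =
      fun y => ∑ n ∈ Finset.range N, ((n ! : ℂ)⁻¹ • iteratedFDeriv ℂ n h c fun _ => y - c) := rfl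
  rw [this]
  exact Differentiable.fun_sum fun n _ => (differentiable_iteratedFDeriv_diag h c n).const_smul _

/-- Taylor polynomials are `C^∞` (over `ℂ`). [folklore] -/
theorem contDiff_taylorPolynomial (h : E → F) (c : E) (N : ℕ) {m : WithTop ℕ∞} :
    ContDiff ℂ m (taylorPolynomial h c N) := by
  have : taylorPolynomial h c N =
      fun y => ∑ n ∈ Finset.range N, ((n ! : ℂ)⁻¹ • iteratedFDeriv ℂ n h c fun _ => y - c) := rfl
  rw [this]
  refine ContDiff.sum fun n _ => ContDiff.const_smul _ ?_
  exact (iteratedFDeriv ℂ n h c).contDiff.comp (contDiff_pi.2 fun _ => contDiff_id.sub contDiff_const)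

/-! ### Slices and the Taylor coefficients -/

section Slice

variable [CompleteSpace F]

/-- On the slice `t ↦ h (c + t • v)` of a function holomorphic on an open set containing `c`, the
`n`-th derivative at `0` is the diagonal value `Dⁿh(c)(v, …, v)`. [folklore] -/
theorem iteratedDeriv_slice_zero [FiniteDimensional ℂ E] {h : E → F} {U : Set E}
    (hh : DifferentiableOn ℂ h U) (hU : IsOpen U) {c : E} (hc : c ∈ U) (v : E) (n : ℕ) :
    iteratedDeriv n (fun t : ℂ => h (c + t • v)) 0 = iteratedFDeriv ℂ n h c fun _ => v := by
  have h0 : (0 : ℂ) ∈ {t : ℂ | c + t • v ∈ U} := by simpa using hc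
  rw [SCV.iteratedDeriv_slice_eqOn hh hU c v n h0]
  beta_reduce
  rw [zero_smul, add_zero, SCV.iterate_fderiv_apply_eq_iteratedFDeriv hU (SCV.contDiffOn_infty hh hU)
    v n hc]

end Slice

/-! ### Uniform convergence on smaller balls -/

section Approx

variable [CompleteSpace F] [FiniteDimensional ℂ E]

/-- **Cauchy estimate for the Taylor coefficients, uniform on a closed ball**: if `h` is
holomorphic on `ball c R`, `0 < s < R' < R` and `‖h‖ ≤ M` on `closedBall c R'`, then for
`y ∈ closedBall c s`, `‖(n!)⁻¹ • Dⁿh(c)(y-c,…,y-c)‖ ≤ M / (R'/s)ⁿ` (Hörmander (1973), Thm. 2.2.7,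
on the complex line through `c` and `y`). [cite: HormanderSCV1973, Thm. 2.2.7] -/
theorem norm_taylorCoeff_le {h : E → F} {c : E} {R R' s M : ℝ} (hh : DifferentiableOn ℂ h (ball c R))
    (hs : 0 < s) (hsR' : s < R') (hR'R : R' < R) (hM : ∀ z ∈ closedBall c R', ‖h z‖ ≤ M)
    {y : E} (hy : y ∈ closedBall c s) (n : ℕ) :
    ‖(n ! : ℂ)⁻¹ • iteratedFDeriv ℂ n h c (fun _ => y - c)‖ ≤ M / (R' / s) ^ n := by
  set ρ : ℝ := R' / s with hρ
  have hρ1 : 1 < ρ := (one_lt_div hs).2 hsR'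
  have hρ0 : 0 < ρ := one_pos.trans hρ1
  have hyc : ‖y - c‖ ≤ s := by rwa [mem_closedBall, dist_eq_norm] at hy
  -- the slice is holomorphic on the disc `|t| < R/s ⊇ closedBall 0 ρ`
  set sl : ℂ → F := fun t => h (c + t • (y - c)) with hsl
  have hmaps : ∀ t : ℂ, ‖t‖ ≤ ρ → c + t • (y - c) ∈ closedBall c R' := by
    intro t ht
    rw [mem_closedBall, dist_eq_norm, add_sub_cancel_left, norm_smul]
    calc ‖t‖ * ‖y - c‖ ≤ ρ * s := mul_le_mul ht hyc (norm_nonneg _) hρ0.le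
      _ = R' := by rw [hρ]; field_simp
  have hball : closedBall c R' ⊆ ball c R := closedBall_subset_ball hR'R
  obtain ⟨ρ', hρρ', hρ'⟩ : ∃ ρ' > ρ, ∀ t : ℂ, ‖t‖ < ρ' → c + t • (y - c) ∈ ball c R := by
    by_cases hyc0 : y - c = 0
    · exact ⟨ρ + 1, by linarith, fun t _ => by simp [hyc0, mem_ball, (hs.trans (hsR'.trans hR'R))]⟩
    · have hpos : 0 < ‖y - c‖ := norm_pos_iff.2 hyc0
      refine ⟨R / ‖y - c‖, ?_, fun t ht => ?_⟩
      · rw [gt_iff_lt, hρ, lt_div_iff₀ hpos]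
        calc R' / s * ‖y - c‖ ≤ R' / s * s := by gcongr
          _ = R' := by field_simp
          _ < R := hR'R
      · rw [mem_ball, dist_eq_norm, add_sub_cancel_left, norm_smul]
        rwa [lt_div_iff₀ hpos] at ht
  have hsld : DifferentiableOn ℂ sl (ball 0 ρ') := by
    intro t ht
    rw [mem_ball, dist_zero_right] at ht
    exact ((hh _ (hρ' t ht)).differentiableAt (isOpen_ball.mem_nhds (hρ' t ht))).comp_differentiableWithinAt
      t (by fun_prop)
  have hslc : DiffContOnCl ℂ sl (ball 0 ρ) :=
    ⟨hsld.mono (ball_subset_ball hρρ'.le),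
      (hsld.mono (closure_ball_subset_closedBall.trans (closedBall_subset_ball hρρ'))).continuousOn⟩
  -- Cauchy's inequality on the circle of radius `ρ`
  have hC : ∀ t ∈ sphere (0 : ℂ) ρ, ‖sl t‖ ≤ M := fun t ht =>
    hM _ (hmaps t (by rw [mem_sphere, dist_zero_right] at ht; exact ht.le))
  have hest := Complex.norm_iteratedDeriv_le_of_forall_mem_sphere_norm_le n hρ0 hslc hC
  rw [iteratedDeriv_slice_zero hh isOpen_ball (mem_ball_self (hs.trans (hsR'.trans hR'R))) (y - c) n]
    at hest
  rw [norm_smul, norm_inv, Complex.norm_natCast]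
  calc (n ! : ℝ)⁻¹ * ‖iteratedFDeriv ℂ n h c fun _ => y - c‖
      ≤ (n ! : ℝ)⁻¹ * (n ! * M / ρ ^ n) := by gcongr
    _ = M / ρ ^ n := by field_simp

/-- **The Taylor series of a holomorphic function converges on the ball, pointwise**:
`h y = ∑_n (n!)⁻¹ Dⁿh(c)(y-c,…,y-c)` for `y ∈ ball c R` (Hörmander (1973), Thm. 2.2.6, via the
complex line through `c` and `y`). [cite: HormanderSCV1973, Thm. 2.2.6] -/
theorem hasSum_taylorCoeff {h : E → F} {c : E} {R : ℝ} (hh : DifferentiableOn ℂ h (ball c R))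
    {y : E} (hy : y ∈ ball c R) :
    HasSum (fun n => (n ! : ℂ)⁻¹ • iteratedFDeriv ℂ n h c fun _ => y - c) (h y) := by
  have hR : 0 < R := pos_of_mem_ball hy
  have hyc : ‖y - c‖ < R := by rwa [mem_ball, dist_eq_norm] at hy
  -- the slice through `c` and `y` is holomorphic on a disc of radius `> 1`
  obtain ⟨ρ', hρ'1, hρ'⟩ : ∃ ρ' > (1 : ℝ), ∀ t : ℂ, ‖t‖ < ρ' → c + t • (y - c) ∈ ball c R := by
    by_cases hyc0 : y - c = 0
    · exact ⟨2, by norm_num, fun t _ => by simp [hyc0, mem_ball, hR]⟩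
    · have hpos : 0 < ‖y - c‖ := norm_pos_iff.2 hyc0
      refine ⟨R / ‖y - c‖, (one_lt_div hpos).2 hyc, fun t ht => ?_⟩
      rw [mem_ball, dist_eq_norm, add_sub_cancel_left, norm_smul]
      rwa [lt_div_iff₀ hpos] at ht
  have hsld : DifferentiableOn ℂ (fun t : ℂ => h (c + t • (y - c))) (ball 0 ρ') := by
    intro t ht
    rw [mem_ball, dist_zero_right] at ht
    exact ((hh _ (hρ' t ht)).differentiableAt (isOpen_ball.mem_nhds (hρ' t ht))).comp_differentiableWithinAt
      t (by fun_prop)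
  have h1 : (1 : ℂ) ∈ ball (0 : ℂ) ρ' := by simpa using hρ'1
  have hsum := Complex.hasSum_taylorSeries_on_ball hsld h1
  simp only [sub_zero, one_pow, one_smul, add_sub_cancel] at hsum
  convert hsum using 1
  funext n
  rw [iteratedDeriv_slice_zero hh isOpen_ball (mem_ball_self hR) (y - c) n]

/-- Uniform convergence of the Taylor polynomials on `closedBall c s` for `0 < s < R`.
[cite: HormanderSCV1973, Thm. 2.2.6] -/
theorem tendstoUniformlyOn_taylorPolynomial_of_pos {h : E → F} {c : E} {R s : ℝ}
    (hh : DifferentiableOn ℂ h (ball c R)) (hs : 0 < s) (hsR : s < R) :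
    TendstoUniformlyOn (fun N => taylorPolynomial h c N) h atTop (closedBall c s) := by
  haveI : ProperSpace E := FiniteDimensional.proper_rclike ℂ E
  obtain ⟨R', hsR', hR'R⟩ := exists_between hsR
  -- a bound on the compact ball `closedBall c R'`
  obtain ⟨M, hM⟩ : ∃ M, ∀ z ∈ closedBall c R', ‖h z‖ ≤ M :=
    (isCompact_closedBall c R').exists_bound_of_continuousOn
      (hh.continuousOn.mono (closedBall_subset_ball hR'R))
  set ρ : ℝ := R' / s with hρ
  have hρ1 : 1 < ρ := (one_lt_div hs).2 hsR'
  have hq0 : 0 ≤ ρ⁻¹ := inv_nonneg.2 (zero_le_one.trans hρ1.le)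
  have hq1 : ρ⁻¹ < 1 := inv_lt_one_of_one_lt₀ hρ1
  -- geometric tail bound
  rw [Metric.tendstoUniformlyOn_iff]
  intro ε hε
  have hgeo : Tendsto (fun N : ℕ => M * (ρ⁻¹) ^ N / (1 - ρ⁻¹)) atTop (𝓝 (M * 0 / (1 - ρ⁻¹))) :=
    (((tendsto_pow_atTop_nhds_zero_of_lt_one hq0 hq1).const_mul M).div_const _)
  rw [mul_zero, zero_div] at hgeo
  filter_upwards [hgeo.eventually (gt_mem_nhds hε)] with N hN y hy
  have hsum := hasSum_taylorCoeff hh (closedBall_subset_ball hsR hy)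
  -- `h y - T_N y` is the tail of the series
  have htail : HasSum (fun n => ((n + N) ! : ℂ)⁻¹ • iteratedFDeriv ℂ (n + N) h c fun _ => y - c)
      (h y - taylorPolynomial h c N y) :=
    (hasSum_nat_add_iff' N).2 hsum
  have hbd : ∀ n, ‖((n + N) ! : ℂ)⁻¹ • iteratedFDeriv ℂ (n + N) h c (fun _ => y - c)‖ ≤
      M * (ρ⁻¹) ^ N * (ρ⁻¹) ^ n := by
    intro n
    have := norm_taylorCoeff_le hh hs hsR' hR'R hM hy (n + N)
    rw [div_eq_mul_inv, ← inv_pow, pow_add] at this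
    linarith [this]
  have hgsum : HasSum (fun n : ℕ => M * (ρ⁻¹) ^ N * (ρ⁻¹) ^ n) (M * (ρ⁻¹) ^ N / (1 - ρ⁻¹)) := by
    rw [div_eq_mul_inv]
    exact (hasSum_geometric_of_lt_one hq0 hq1).mul_left _
  rw [dist_eq_norm, ← htail.tsum_eq]
  exact (tsum_of_norm_bounded hgsum hbd).trans_lt hN

/-- **Uniform convergence of the Taylor polynomials on smaller closed balls**
(Hörmander (1973), Thm. 2.2.6 with 2.2.7): for `h` holomorphic on `ball c R` and `s < R`,
`taylorPolynomial h c N → h` uniformly on `closedBall c s`. [cite: HormanderSCV1973, Thm. 2.2.6] -/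
theorem tendstoUniformlyOn_taylorPolynomial {h : E → F} {c : E} {R s : ℝ}
    (hh : DifferentiableOn ℂ h (ball c R)) (hsR : s < R) :
    TendstoUniformlyOn (fun N => taylorPolynomial h c N) h atTop (closedBall c s) := by
  by_cases hR : R ≤ 0
  · rw [closedBall_eq_empty.2 (by linarith)]
    exact tendstoUniformlyOn_empty
  · push Not at hR
    have hs' : 0 < max s (R / 2) := lt_max_of_lt_right (by linarith)
    exact (tendstoUniformlyOn_taylorPolynomial_of_pos hh hs' (max_lt hsR (by linarith))).mono
      (closedBall_subset_closedBall (le_max_left _ _))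

/-- **Uniform approximation by entire functions on smaller balls** ("concentric Runge"): for `h`
holomorphic on `ball c R`, `s < R` and `ε > 0` there is an entire (`ℂ`-differentiable on `E`)
`g` with `‖h y - g y‖ ≤ ε` on `closedBall c s` — a Taylor polynomial of `h`
(Hörmander (1973), Thm. 2.2.6/2.2.7; used in the proof of Thm. 2.7.8, case `q = 0`).
[cite: HormanderSCV1973, Thm. 2.2.6] -/
theorem exists_entire_approx_on_closedBall {h : E → F} {c : E} {R s : ℝ}
    (hh : DifferentiableOn ℂ h (ball c R)) (hsR : s < R) {ε : ℝ} (hε : 0 < ε) :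
    ∃ g : E → F, Differentiable ℂ g ∧ ∀ y ∈ closedBall c s, ‖h y - g y‖ ≤ ε := by
  obtain ⟨N, hN⟩ := (Metric.tendstoUniformlyOn_iff.1 (tendstoUniformlyOn_taylorPolynomial hh hsR) ε hε).exists
  exact ⟨taylorPolynomial h c N, differentiable_taylorPolynomial h c N, fun y hy =>
    (dist_eq_norm (h y) _ ▸ (hN y hy).le)⟩

end Approx

end Literature.Analysis.Complex
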